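import Summits.CriticalPhenomena.CardyFormulaZ2.Theorems.CardyComplexConeEdgePrecompactUFRSFailureStructure
import Summits.CriticalPhenomena.CardyFormulaZ2.Theorems.CardyComplexConeEdgePrecompactResponseStabilityReduction

/-!
# FACE discrepancies sit at the exit corner of the translate
(line `qkz-strip-boundary-arm` of crux `CardyComplexCone.EdgePrecompact`, stmt-CriticalPhenomena-11387;
item 4 of the road map for the uniform forward response stability "UFRS", module docstring of
`Theorems/CardyComplexConeEdgePrecompactUniformForwardResponseStability.lean`, the FACE case)

`ufrs_failureStructure` (`…EdgePrecompactUFRSFailureStructure.lean`) localises a forward-response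
failure which is not INITIAL at a last synchronised corner `e = O₀ a m = O₁ a' k` followed by a
FACE or a SPLIT discrepancy. This file settles WHERE a FACE discrepancy sits, completely and
deterministically: **`e` is THE exit corner of the translated datum `E₁ = shiftData E w`** — the
unique corner with vertex on the discrete arc `A₁`, target edge ending on `B₁` and targeted at
its `A₁`-end (`IsInEdge`); its target edge is the exit edge `e_b + w` of `E₁` (an `A₁`–`B₁` edge
other than the entry edge `cSrc` of the start corner), closed in both completed configurations —
and the `β₀`-orbit CONTINUES from this deterministic corner through inner faces of `E`, outside
the ball, into the ball `B(E.δ v, ρ)` (`ufrs_faceExit`, registered vocabulary). So the FACE part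
of the failure event is contained in the single event "the completed orbit of `E` started at the
exit corner of `shiftData E w` makes a ball-avoiding inner stretch of positive length entering the
ball": one strand from the marked point `b_δ + E.δ w` to distance `≥ ρ - 3η` (two arms at the
marked point `b`, item 4 of the road map; the probability estimate is not here).

Ingredients: `orbit_exit_or_stuck` (`…ResponseLocalisation.lean`) for the translate, whose
"stuck at an arc-`B` vertex" alternative is excluded for a start corner (vertex on `A₁`) and for
an exit corner of the ball (deep vertex, all faces inner for both data by `collarAgreement`);
uniqueness of the exit corner (`exitCorner_unique`: the exit edges are `A`–`B` edges distinct
from the entry edge, `ncard_zdABEdges_eq_two`, `eq_of_cSrc_eq_of_arcs`).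

References: S. Smirnov, C. R. Acad. Sci. Paris 333 (2001), §2 (the exploration path runs from
`e_a` to `e_b`); G. Grimmett, *Percolation* (1999), §11.2.
-/

namespace Summit.CriticalPhenomena.CardyFormulaZ2.Cruxes.EdgePrecompact.QkzStripBoundaryArm

open MeasureTheory Filter Set Metric
open scoped Topology BigOperators Pointwise
open Literature.Probability.LatticeModels Literature.Probability.Percolation
open Literature.Probability.RandomPlanarGeometry (DobrushinDomain)
open Summit.CriticalPhenomena.CardyFormulaZ2.Theses.CardyComplexCone

noncomputable section

/-! ## The exit corner of admissible data -/

/-- An exit-type corner (vertex on `A`, target edge ending on `B`, targeted at the vertex) does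
not target the entry edge `cSrc c₀` of a start corner `c₀` (that edge is SOURCED at its `A`-end). -/
theorem cTgt_ne_cSrc_of_isInEdge {D : DiscreteDobrushin} (hD : D.IsZdAdmissible) {c₀ q : Site 2 × Fin 4}
    (hc₀ : D.IsStartCorner c₀) (hqA : q.1 ∈ D.zdArcA) (hqIn : D.IsInEdge q.1 (q.2 + 1)) :
    cTgt q ≠ cSrc c₀ := by
  intro h
  have := DiscreteDobrushin.eq_of_cSrc_eq_of_arcs hD (p := (q.1, q.2 + 1)) (q := c₀) hqA
    hc₀.mem_zdArcB h
  have hout := hc₀.isOutEdge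
  rw [← this] at hout
  exact hout.not_isInEdge hqIn

/-- **The exit corner is unique.** For admissible data, two corners with vertex on the arc `A`,
target edge ending on the arc `B` and targeted at the vertex (`IsInEdge`) are equal: their target
edges are `A`–`B` edges other than the entry edge of the start corner, there are exactly two
`A`–`B` edges, and an edge from `A` to `B` determines its corner at the `A`-end. -/
theorem exitCorner_unique {D : DiscreteDobrushin} (hD : D.IsZdAdmissible) {q q' : Site 2 × Fin 4}
    (hqA : q.1 ∈ D.zdArcA) (hqB : q.1 + cornerUnit (q.2 + 1) ∈ D.zdArcB) (hqIn : D.IsInEdge q.1 (q.2 + 1))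
    (hqA' : q'.1 ∈ D.zdArcA) (hqB' : q'.1 + cornerUnit (q'.2 + 1) ∈ D.zdArcB)
    (hqIn' : D.IsInEdge q'.1 (q'.2 + 1)) : q = q' := by
  obtain ⟨c₀, ⟨hA₀, hB₀, hout₀⟩, -⟩ := DiscreteDobrushin.existsUnique_startCorner hD
  have hc₀ : D.IsStartCorner c₀ := ⟨hA₀, hB₀, hout₀⟩
  have hea : cSrc c₀ ∈ D.zdABEdges := DiscreteDobrushin.cSrc_mem_zdABEdges hA₀ hB₀ (Or.inl hout₀)
  have heq : cTgt q ∈ D.zdABEdges := DiscreteDobrushin.cSrc_mem_zdABEdges hqA hqB (Or.inr hqIn)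
  have heq' : cTgt q' ∈ D.zdABEdges := DiscreteDobrushin.cSrc_mem_zdABEdges hqA' hqB' (Or.inr hqIn')
  have h1 : cTgt q ≠ cSrc c₀ := cTgt_ne_cSrc_of_isInEdge hD hc₀ hqA hqIn
  have h2 : cTgt q' ≠ cSrc c₀ := cTgt_ne_cSrc_of_isInEdge hD hc₀ hqA' hqIn'
  obtain ⟨x, y, -, hS⟩ := Set.ncard_eq_two.1 hD.ncard_zdABEdges_eq_two
  rw [hS] at hea heq heq'
  simp only [Set.mem_insert_iff, Set.mem_singleton_iff] at hea heq heq'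
  have key : cTgt q = cTgt q' := by
    rcases hea with hea | hea <;> rcases heq with heq | heq <;> rcases heq' with heq' | heq'
    all_goals first
      | exact absurd (heq.trans hea.symm) h1
      | exact absurd (heq'.trans hea.symm) h2
      | exact heq.trans heq'.symm
  have := DiscreteDobrushin.eq_of_cSrc_eq_of_arcs hD (p := (q.1, q.2 + 1)) (q := (q'.1, q'.2 + 1))
    hqA hqB' key
  rw [Prod.mk.injEq] at this
  exact Prod.ext this.1 (add_right_cancel this.2)

/-- **Where an orbit leaves the inner faces, away from the arc `B`: at THE exit corner.** For
admissible data, if the orbit of a corner `c` whose vertex is not on the arc `B` sits in an inner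
face at time `k` and not at time `k + 1`, then the corner `e = O c k` is the exit corner: its
target edge is closed, an `A`–`B` edge targeted at its `A`-end, distinct from the entry edge of
every start corner, and every exit-type corner equals `e`. -/
theorem orbit_exitCorner {E : DiscreteDobrushin} (hE : E.IsZdAdmissible) (ω : BondConfig (Site 2))
    (c : Site 2 × Fin 4) {k : ℕ} (hcB : c.1 ∉ E.zdArcB)
    (hin : E.IsInnerFace (cFace (cornerOrbit (E.bcBondConfig ω) c k)))
    (hout : ¬ E.IsInnerFace (cFace (cornerOrbit (E.bcBondConfig ω) c (k + 1)))) :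
    cTgt (cornerOrbit (E.bcBondConfig ω) c k) ∉ E.bcBondConfig ω ∧
      (cornerOrbit (E.bcBondConfig ω) c k).1 ∈ E.zdArcA ∧
      (cornerOrbit (E.bcBondConfig ω) c k).1 + cornerUnit ((cornerOrbit (E.bcBondConfig ω) c k).2 + 1)
        ∈ E.zdArcB ∧
      E.IsInEdge (cornerOrbit (E.bcBondConfig ω) c k).1 ((cornerOrbit (E.bcBondConfig ω) c k).2 + 1) ∧
      cTgt (cornerOrbit (E.bcBondConfig ω) c k) ∈ E.zdABEdges ∧
      (∀ c₀ : Site 2 × Fin 4, E.IsStartCorner c₀ → cTgt (cornerOrbit (E.bcBondConfig ω) c k) ≠ cSrc c₀) ∧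
      (∀ q : Site 2 × Fin 4, q.1 ∈ E.zdArcA → q.1 + cornerUnit (q.2 + 1) ∈ E.zdArcB →
        E.IsInEdge q.1 (q.2 + 1) → q = cornerOrbit (E.bcBondConfig ω) c k) := by
  rcases orbit_exit_or_stuck hE ω c hin hout with ⟨hB, -⟩ | ⟨hclosed, hA, hB, hIn, hAB⟩
  · exact absurd hB hcB
  · exact ⟨hclosed, hA, hB, hIn, hAB, fun c₀ hc₀ => cTgt_ne_cSrc_of_isInEdge hE hc₀ hA hIn,
      fun q hqA hqB hqIn => exitCorner_unique hE hqA hqB hqIn hA hB hIn⟩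

/-- **FACE discrepancies sit at a marked edge of the datum, translated** (registered sub-goal
`ufrs_faceExitAtMarkedEdge` of stmt-CriticalPhenomena-11387, formulated by worker W1 of lead c1 and
re-proved here from `orbit_exitCorner`): where the completed orbit of the translate
`shiftData E w` leaves its inner faces, away from its arc `B`, the edge just reached is closed,
read at its `A`-end, and is the translate by `w` of an `A`–`B` edge `e₀` of `E` — at distance
exactly `‖E.δ w‖` from it. -/
theorem ufrs_faceExitAtMarkedEdge : ∀ (E : DiscreteDobrushin) (w : Site 2) (ω : BondConfig (Site 2)) (c : Site 2 × Fin 4) (k : ℕ), E.IsZdAdmissible → c.1 ∉ (shiftData E w).zdArcB → (shiftData E w).IsInnerFace (cFace (cornerOrbit ((shiftData E w).bcBondConfig ω) c k)) → ¬ (shiftData E w).IsInnerFace (cFace (cornerOrbit ((shiftData E w).bcBondConfig ω) c (k + 1))) → cTgt (cornerOrbit ((shiftData E w).bcBondConfig ω) c k) ∉ (shiftData E w).bcBondConfig ω ∧ (cornerOrbit ((shiftData E w).bcBondConfig ω) c k).1 ∈ (shiftData E w).zdArcA ∧ ∃ e₀ ∈ E.zdABEdges, cTgt (cornerOrbit ((shiftData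 E w).bcBondConfig ω) c k) = sym2Equiv (Site.shift w) e₀ ∧ dist (medialPoint E.δ (cTgt (cornerOrbit ((shiftData E w).bcBondConfig ω) c k))) (medialPoint E.δ e₀) = ‖meshPoint E.δ w‖ := by
  intro E w ω c k hE hcB hin hout
  have hE₁ : (shiftData E w).IsZdAdmissible := isZdAdmissible_shiftData E w hE
  obtain ⟨hclosed, hA, -, -, hAB, -⟩ := orbit_exitCorner hE₁ ω c hcB hin hout
  set e := cTgt (cornerOrbit ((shiftData E w).bcBondConfig ω) c k) with he
  have hback : sym2Equiv (Site.shift w) ((sym2Equiv (Site.shift w)).symm e) = e :=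
    Equiv.apply_symm_apply _ _
  refine ⟨hclosed, hA, (sym2Equiv (Site.shift w)).symm e, ?_, hback.symm, ?_⟩
  · rw [← shift_mem_zdABEdges_iff E w, hback]
    exact hAB
  · have hpt : medialPoint E.δ e = medialPoint E.δ ((sym2Equiv (Site.shift w)).symm e) + meshPoint E.δ w := by
      conv_lhs => rw [← hback]
      exact medialPoint_shift E.δ w _
    rw [hpt, dist_eq_norm, add_sub_cancel_left]

/-! ## FACE discrepancies in UFRS -/

/-- **FACE discrepancies sit at the exit corner of the translate** (UFRS vocabulary; consumes the
FACE branch of `ufrs_failureStructure` verbatim). For `η > 0` there is `δ₀ > 0` such that for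
every admissible datum `E` of `D` with `E.δ < δ₀`, shift `w` with `‖E.δ w‖ < η`, ball
`B(E.δ v, ρ)` with `4η ≤ ρ`, `2ρ ≤ infDist (E.δ v) Dᶜ`, configuration `ω`, admissible pair
`(a, a')`, re-entry time `n` of the `β₀`-orbit of `a` (good stretch, target at `n` in the ball)
and synchronised index `m < n` (`O₁ a' k = O₀ a m` through inner faces of `E₁ = shiftData E w`)
followed by a FACE discrepancy (equal status of the target edge of `e = O₀ a m`, common next
corner, whose face is not inner for `E₁`): (1) `e` is exit-type for `E₁` and every exit-type
corner of `E₁` equals `e` (so `e` depends on `E`, `w` only); (2) its target edge is an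
`A₁`–`B₁` edge of `E₁`, other than the entry edge of any start corner of `E₁`, closed in BOTH
completed configurations; (3) the vertex of `e` lies in the `3η`-collar; (4) the `β₀`-orbit of
`e` makes a good `E`-stretch of length `n - m ≥ 1` outside the ball and enters the ball at time
`n - m`. -/
theorem ufrs_faceExit : ∀ (D : DobrushinDomain) (η : ℝ), 0 < η → ∃ δ₀ > (0:ℝ), ∀ E : DiscreteDobrushin, E.Ω = D.carrier → E.IsZdAdmissible → E.δ < δ₀ → ∀ (v w : Site 2) (ρ : ℝ), 4 * η ≤ ρ → 2 * ρ ≤ infDist (meshPoint E.δ v) D.carrierᶜ → ‖meshPoint E.δ w‖ < η → ∀ (ω : BondConfig (Site 2)) (a a' : Site 2 × Fin 4) (n m k : ℕ), ((E.IsStartCorner a ∧ (shiftData E w).IsStartCorner a') ∨ (a = a' ∧ medialPoint E.δ (cSrc a) ∈ ball (meshPoint E.δ v) ρ ∧ medialPoint E.δ (cTgt a) ∉ ball (meshPoint E.δ v) ρ)) → (∀ i < n, medialPoint E.δ (cTgt (cornerOrbit (E.bcBondConfig ω) a i)) ∉ ball (meshPoint E.δ v) ρ ∧ E.IsInnerFace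 (cFace (cornerOrbit (E.bcBondConfig ω) a (i + 1)))) → medialPoint E.δ (cTgt (cornerOrbit (E.bcBondConfig ω) a n)) ∈ ball (meshPoint E.δ v) ρ → m < n → (∀ i < k, (shiftData E w).IsInnerFace (cFace (cornerOrbit ((shiftData E w).bcBondConfig ω) a' (i + 1)))) → cornerOrbit ((shiftData E w).bcBondConfig ω) a' k = cornerOrbit (E.bcBondConfig ω) a m → (cTgt (cornerOrbit (E.bcBondConfig ω) a m) ∈ E.bcBondConfig ω ↔ cTgt (cornerOrbit (E.bcBondConfig ω) a m) ∈ (shiftData E w).bcBondConfig ω) → cornerOrbit ((shiftData E w).bcBondConfig ω) a' (k + 1) = cornerOrbit (E.bcBondConfig ω) a (m + 1) → ¬ (shiftData E w).IsInnerFace (cFace (cornerOrbit (E.bcBondConfig ω) a (m + 1))) → ((cornerOrbit (E.bcBondConfig ω) a m).1 ∈ (shiftData E w).zdArcA ∧ (cornerOrbit (E.bcBondConfig ω) a m).1 + cornerUnit ((cornerOrbit (E.bcBondConfig ω) a m).2 + 1) ∈ (shiftData E w).zdArcB ∧ (shiftData E w).IsInEdge (cornerOrbit (E.bcBondConfig ω)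 a m).1 ((cornerOrbit (E.bcBondConfig ω) a m).2 + 1) ∧ ∀ q : Site 2 × Fin 4, q.1 ∈ (shiftData E w).zdArcA → q.1 + cornerUnit (q.2 + 1) ∈ (shiftData E w).zdArcB → (shiftData E w).IsInEdge q.1 (q.2 + 1) → q = cornerOrbit (E.bcBondConfig ω) a m) ∧ (cTgt (cornerOrbit (E.bcBondConfig ω) a m) ∈ (shiftData E w).zdABEdges ∧ (∀ c₁ : Site 2 × Fin 4, (shiftData E w).IsStartCorner c₁ → cTgt (cornerOrbit (E.bcBondConfig ω) a m) ≠ cSrc c₁) ∧ cTgt (cornerOrbit (E.bcBondConfig ω) a m) ∉ E.bcBondConfig ω ∧ cTgt (cornerOrbit (E.bcBondConfig ω) a m) ∉ (shiftData E w).bcBondConfig ω) ∧ infDist (meshPoint E.δ (cornerOrbit (E.bcBondConfig ω) a m).1) D.carrierᶜ < 3 * η ∧ (1 ≤ n - m ∧ (∀ i < n - m, medialPoint E.δ (cTgt (cornerOrbit (E.bcBondConfig ω) (cornerOrbit (E.bcBondConfig ω) a m) i)) ∉ ball (meshPoint E.δ v) ρ ∧ E.IsInnerFace (cFace (cornerOrbit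 (E.bcBondConfig ω) (cornerOrbit (E.bcBondConfig ω) a m) (i + 1)))) ∧ medialPoint E.δ (cTgt (cornerOrbit (E.bcBondConfig ω) (cornerOrbit (E.bcBondConfig ω) a m) (n - m))) ∈ ball (meshPoint E.δ v) ρ) := by
  intro D η hη
  obtain ⟨δ₁, hδ₁, hcollar⟩ := collarAgreement D η hη
  refine ⟨min δ₁ η, lt_min hδ₁ hη, ?_⟩
  intro E hEΩ hE hEδ v w ρ hηρ hv hw ω a a' n m k hpair hStr hball hmn hStr₁ hek hiff hstep hnot
  have hδ : 0 < E.δ := hE.delta_pos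
  have hδ₁' : E.δ < δ₁ := lt_of_lt_of_le hEδ (min_le_left _ _)
  have hδη : E.δ ≤ η := (lt_of_lt_of_le hEδ (min_le_right _ _)).le
  have hE₁ : (shiftData E w).IsZdAdmissible := isZdAdmissible_shiftData E w hE
  -- faces at deep vertices are inner for both data
  have hinner : ∀ x : Site 2, 3 * η ≤ infDist (meshPoint E.δ x) D.carrierᶜ → ∀ f : Site 2,
      IsCorner x f → E.IsInnerFace f ∧ (shiftData E w).IsInnerFace f := fun x hx =>
    (hcollar E hEΩ hE hδ₁' w hw ω x hx x (by rw [dist_self]; positivity)).2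
  set e := cornerOrbit (E.bcBondConfig ω) a m with he
  -- the face at `β₁`-time `k` is inner, at `k + 1` it is not
  have hout : ¬ (shiftData E w).IsInnerFace
      (cFace (cornerOrbit ((shiftData E w).bcBondConfig ω) a' (k + 1))) := by rw [hstep]; exact hnot
  have hin : (shiftData E w).IsInnerFace (cFace (cornerOrbit ((shiftData E w).bcBondConfig ω) a' k)) := by
    rcases Nat.eq_zero_or_pos k with rfl | hk
    · rcases hpair with ⟨-, ha'⟩ | ⟨rfl, haI, -⟩
      · exact ha'.isOutEdge.1
      · exact (hinner a.1 (deep_of_cSrc_mem_ball hδ.le hδη hηρ hv haI) _ (isCorner_cFace a)).2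
    · obtain ⟨k', rfl⟩ : ∃ k', k = k' + 1 := ⟨k - 1, by omega⟩
      exact hStr₁ k' (Nat.lt_succ_self k')
  -- the orbit is not stuck at an arc-`B` vertex: it leaves through the exit edge
  have hexit : cTgt (cornerOrbit ((shiftData E w).bcBondConfig ω) a' k) ∉ (shiftData E w).bcBondConfig ω ∧
      (cornerOrbit ((shiftData E w).bcBondConfig ω) a' k).1 ∈ (shiftData E w).zdArcA ∧
      (cornerOrbit ((shiftData E w).bcBondConfig ω) a' k).1 +
          cornerUnit ((cornerOrbit ((shiftData E w).bcBondConfig ω) a' k).2 + 1) ∈ (shiftData E w).zdArcB ∧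
      (shiftData E w).IsInEdge (cornerOrbit ((shiftData E w).bcBondConfig ω) a' k).1
          ((cornerOrbit ((shiftData E w).bcBondConfig ω) a' k).2 + 1) ∧
      cTgt (cornerOrbit ((shiftData E w).bcBondConfig ω) a' k) ∈ (shiftData E w).zdABEdges := by
    rcases orbit_exit_or_stuck hE₁ ω a' hin hout with ⟨haB, hstay⟩ | ⟨hclosed, hA, hB, hIn, hAB⟩
    · exfalso
      rcases hpair with ⟨-, ha'⟩ | ⟨rfl, haI, -⟩
      · exact Set.disjoint_left.1 hE₁.disjoint ha'.mem_zdArcA haB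
      · apply hout
        have hv1 : (cornerOrbit ((shiftData E w).bcBondConfig ω) a (k + 1)).1 = a.1 :=
          hstay (k + 1) le_rfl
        have hc := isCorner_cFace (cornerOrbit ((shiftData E w).bcBondConfig ω) a (k + 1))
        rw [hv1] at hc
        exact (hinner a.1 (deep_of_cSrc_mem_ball hδ.le hδη hηρ hv haI) _ hc).2
    · exact ⟨hclosed, hA, hB, hIn, hAB⟩
  rw [hek] at hexit
  obtain ⟨hclosed₁, hA, hB, hIn, hAB⟩ := hexit
  have hclosed₀ : cTgt e ∉ E.bcBondConfig ω := fun h => hclosed₁ (hiff.1 h)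
  -- the vertex of `e` is in the collar: one of its faces is not inner for `E₁`
  have hcol : infDist (meshPoint E.δ e.1) D.carrierᶜ < 3 * η := by
    by_contra hdeep
    rw [not_lt] at hdeep
    exact hIn.2 (hinner e.1 hdeep _ (isCorner_faceAt e.1 (e.2 + 1))).2
  refine ⟨⟨hA, hB, hIn, fun q hqA hqB hqIn => exitCorner_unique hE₁ hqA hqB hqIn hA hB hIn⟩,
    ⟨hAB, fun c₁ hc₁ => cTgt_ne_cSrc_of_isInEdge hE₁ hc₁ hA hIn, hclosed₀, hclosed₁⟩, hcol,
    ⟨by omega, fun i hi => ?_, ?_⟩⟩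
  · have := hStr (m + i) (by omega)
    rwa [cornerOrbit_add_eq, show m + i + 1 = m + (i + 1) by ring, cornerOrbit_add_eq] at this
  · have := hball
    rwa [show n = m + (n - m) by omega, cornerOrbit_add_eq] at this

end

end Summit.CriticalPhenomena.CardyFormulaZ2.Cruxes.EdgePrecompact.QkzStripBoundaryArm
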